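import Mathlib
import Summits.NavierStokesRegularity.NavierStokesRegularity.Theorems.FilamentSkeletonRssClause13ModelSliceEstimate
import Summits.NavierStokesRegularity.NavierStokesRegularity.Theorems.FilamentSkeletonRssClause13LowSliceBottom

/-!
# Clause 13-J/13-R, brick B4 (LOW REGIME AS A DIRICHLET FORM): `−Re 𝔔_ℂ(f) ≥ ½log(1/a)·‖f′‖₂²` below `|z|√q ≤ a ≤ 1/10`, and the
# low-regime estimate `G·½log(1/a)·‖Y′‖₂² ≤ ‖𝓛Y‖₂‖Y‖₂ + Λ‖Y′‖₂‖(τ−c)Y‖₂ + (b₁+b₂)‖Y‖₂²` for the full 1-D model operator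

Route `FilamentSkeletonRss`, ∃-side clause 13 (`Clause13RNearStraightL` stmt-NavierStokesRegularity-23612; typing-agnostic); design of record
`filament-plan/DESIGN-NOTE-28296-tenure-g22.md` §2 ("low `k ∈ [c₁/R, 0.58/μ]`: `|σ| ≥ (Γγ/4π)k²(log(2/(μk)) − 1.08) − Λ(R/cg)k` … the `log Γ`
inside `R²` is compensated EXACTLY by the LIA log") and §5 (dyadic sub-slices of S0/S1).  OBSERVATION (this file): the dyadic slicing of the low
regime is unnecessary at model level — below `|z|√q ≤ a` the model self form is a DIRICHLET FORM with logarithmic weight,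
`−(2/q)𝔖(z√q) ≥ (z²/2)·log(1/a)` (from `𝔖(x) ≤ (x²/4)log x`, p672066), so ONE energy identity (the imaginary part of `⟨𝓛Y, Y⟩`, p696039) controls
`‖Y′‖₂²` with the gain `G·½log(1/a)`, against which transport enters as `Λ‖Y′‖₂‖(τ−c)Y‖₂` (absorbable by Young) — no commutators, no
Littlewood–Paley sum:

* §1 `unnormalisedTransform_deriv` — `∫ f′(x)e^{izx}dx = −iz·∫ f(x)e^{izx}dx` for `f ∈ C¹`, `f, f′ ∈ L¹`;
  `integral_norm_sq_deriv_eq_spectral` — `∫‖f′‖² = (1/2π)∫ z²|f̂(z)|²` (`f′ ∈ L¹ ∩ L²`);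
* §2 `spectralForm_le_neg_dirichlet` / `modelSelfForm_re_le_neg_dirichlet` — for `f̂ = 0` on `|z|√q > a`, `0 < a ≤ 1/10`:
  `Re 𝔔_ℂ(f) ≤ −½log(1/a)·∫‖f′‖²`;
* §3 `norm_pairing0_transport_le'` — `‖∫(−wY′)conj Y‖ ≤ Λ‖Y′‖₂‖(τ−c)Y‖₂` (derivative unweighted, weight on `Y`);
  `model_lowRegime_dirichlet_estimate` — **`G·½log(1/a)·∫‖Y′‖² ≤ ‖𝓛Y‖₂‖Y‖₂ + Λ‖Y′‖₂‖(τ−c)Y‖₂ + (b₁+b₂)‖Y‖₂²`** for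
  `𝓛Y = iG·M_qY − wY′ + β₁Y + β₂conj Y`, `Ŷ = 0` on `|z|√q > a`.
With `a ≈ √q/R` (ball scale, after the S0-bottom correction of `…Clause13LowSliceBottom`) the gain is `G·½log(R/√q) ≈ G·¼log Γ`, and Poincaré on the
ball (`…Clause13BallPoincare`) converts `‖Y′‖₂` into `‖Y‖₂/R`: net ball-scale ellipticity `≈ Gq·log Γ/(4R²) = γ/(8πR_b²)·(1+o(1))`, Γ-free, as the
note computes.
Lane ns-filament-19175-p1 g16; `--supports stmt-NavierStokesRegularity-23612 --as helper`.
HONEST FRAMING: inequalities about an explicit 1-D model operator attached to a HYPOTHETICAL filament skeleton on the NEGATIVE side of a MODEL route;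
nothing here bears on Navier–Stokes regularity or blow-up; 23610/23612/23320 stay OPEN.
-/

noncomputable section

open MeasureTheory Real Complex Filter Set
open scoped FourierTransform ComplexConjugate Topology
open Summit.NavierStokesRegularity.NavierStokesRegularity.Theorems.AnalyticStripLiaSymbol (liaSym liaSym_neg liaSym_zero)

namespace Summit.NavierStokesRegularity.NavierStokesRegularity.Theorems.MatchedKernel
set_option linter.dupNamespace false

/-! ## §1 The transform of a derivative and the spectral form of `‖f′‖₂²` -/

/-- **`∫ f′(x)e^{izx}dx = −iz·∫f(x)e^{izx}dx`** for `f ∈ C¹` with `f, f′ ∈ L¹` (integration by parts on the line: `(f·e^{iz·})′` is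
integrable and integrates to zero). [folklore] -/
theorem unnormalisedTransform_deriv {f f' : ℝ → ℂ} (hf : ∀ x, HasDerivAt f (f' x) x) (hfi : Integrable f) (hf'i : Integrable f')
    (z : ℝ) : ∫ x : ℝ, f' x * cexp (I * z * x) = -(I * z) * ∫ x : ℝ, f x * cexp (I * z * x) := by
  -- derivative of `x ↦ e^{izx}`
  have he : ∀ x : ℝ, HasDerivAt (fun x : ℝ => cexp (I * z * x)) (I * z * cexp (I * z * x)) x := by
    intro x
    have h1 : HasDerivAt (fun x : ℝ => I * z * (x : ℂ)) (I * z * 1) x := (hasDerivAt_id x).ofReal_comp.const_mul (I * z)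
    rw [mul_one] at h1
    have h2 := h1.cexp
    convert h2 using 1
    ring
  have hnorm : ∀ x : ℝ, ‖cexp (I * z * x)‖ = 1 := fun x => by
    rw [show I * (z : ℂ) * (x : ℂ) = ((z * x : ℝ) : ℂ) * I by push_cast; ring, Complex.norm_exp_ofReal_mul_I]
  have hcont : Continuous fun x : ℝ => cexp (I * z * x) :=
    Complex.continuous_exp.comp ((continuous_const.mul Complex.continuous_ofReal))
  have hem : AEStronglyMeasurable (fun x : ℝ => cexp (I * z * x)) volume := hcont.aestronglyMeasurable
  -- integrability of `e·g` for integrable `g`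
  have hbdd : ∀ g : ℝ → ℂ, Integrable g → Integrable (fun x : ℝ => g x * cexp (I * z * x)) := by
    intro g hg
    refine (hg.bdd_mul hem (c := 1) (Eventually.of_forall fun x => (hnorm x).le)).congr (Eventually.of_forall fun x => ?_)
    simp only [mul_comm]
  have hprod : ∀ x, HasDerivAt (fun x : ℝ => f x * cexp (I * z * x)) (f' x * cexp (I * z * x) + f x * (I * z * cexp (I * z * x))) x :=
    fun x => (hf x).mul (he x)
  have hI1 : Integrable (fun x : ℝ => f' x * cexp (I * z * x)) := hbdd f' hf'i
  have hI2 : Integrable (fun x : ℝ => f x * (I * z * cexp (I * z * x))) := by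
    refine ((hbdd f hfi).const_mul (I * z)).congr (Eventually.of_forall fun x => ?_)
    ring
  have hzero := integral_eq_zero_of_hasDerivAt_of_integrable hprod (hI1.add hI2) (hbdd f hfi)
  rw [integral_add hI1 hI2] at hzero
  have h2 : ∫ x : ℝ, f x * (I * z * cexp (I * z * x)) = (I * z) * ∫ x : ℝ, f x * cexp (I * z * x) := by
    rw [← integral_const_mul]
    refine integral_congr_ae (Eventually.of_forall fun x => ?_)
    simp only
    ring
  rw [h2] at hzero
  linear_combination hzero

/-- **Spectral form of the Dirichlet integral**: `∫‖f′‖² = (1/2π)∫ z²·|∫f e^{izx}|² dz` for `f ∈ C¹` with `f ∈ L¹` and `f′ ∈ L¹ ∩ L²`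
(Plancherel for `f′` and §1). [folklore] -/
theorem integral_norm_sq_deriv_eq_spectral {f f' : ℝ → ℂ} (hf : ∀ x, HasDerivAt f (f' x) x) (hfi : Integrable f)
    (hf'i : Integrable f') (hf'2 : MemLp f' 2) :
    ∫ x : ℝ, ‖f' x‖ ^ 2 = 1 / (2 * π) * ∫ z : ℝ, z ^ 2 * ‖∫ x : ℝ, f x * cexp (I * z * x)‖ ^ 2 := by
  have hplanch : 1 / (2 * π) * ∫ z : ℝ, ‖∫ x : ℝ, f' x * cexp (I * z * x)‖ ^ 2 = ∫ t : ℝ, ‖f' t‖ ^ 2 := by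
    rw [← Literature.Analysis.FunctionSpaces.integral_norm_sq_fourierIntegral_eq hf'i hf'2, integral_norm_sq_fourier_eq_unnormalised]
  rw [← hplanch]
  congr 1
  refine integral_congr_ae (Eventually.of_forall fun z => ?_)
  simp only
  rw [unnormalisedTransform_deriv hf hfi hf'i z, norm_mul, norm_neg, norm_mul, Complex.norm_I, Complex.norm_real, one_mul,
    Real.norm_eq_abs, mul_pow, sq_abs]

/-! ## §2 The low regime is a Dirichlet form with logarithmic weight -/

/-- Pointwise symbol bound: for `a ≤ 1/10` and `|x| ≤ a`, `𝔖(x) ≤ −(x²/4)·log(1/a)`. [folklore] -/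
theorem liaSym_le_neg_sq_mul_log {a x : ℝ} (ha' : a ≤ 1 / 10) (hx : |x| ≤ a) :
    liaSym x ≤ -(x ^ 2 / 4) * Real.log (1 / a) := by
  by_cases h0 : x = 0
  · rw [h0, liaSym_zero]; norm_num
  · have hpos : 0 < |x| := abs_pos.2 h0
    have h := liaSym_le_of_mem_lowSlice hpos le_rfl (hx.trans ha')
    have hlog : Real.log |x| ≤ Real.log a := Real.log_le_log hpos hx
    have e : -(x ^ 2 / 4) * Real.log (1 / a) = |x| ^ 2 / 4 * Real.log a := by
      rw [one_div, Real.log_inv, ← sq_abs x]; ring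
    rw [e]
    calc liaSym x ≤ |x| ^ 2 / 4 * Real.log |x| := h
      _ ≤ |x| ^ 2 / 4 * Real.log a := by gcongr

/-- **Low regime, spectral side**: if the un-normalised transform `F` of `f ∈ C¹` (`f ∈ L¹∩L²`, `f′ ∈ L¹∩L²`) vanishes for `|z|√q > a`, `0 < a ≤ 1/10`,
then `(1/2π)∫(2/q)𝔖(z√q)|F|² ≤ −½log(1/a)·∫‖f′‖²`. [folklore] -/
theorem spectralForm_le_neg_dirichlet {q a : ℝ} (hq : 0 < q) (ha : 0 < a) (ha' : a ≤ 1 / 10) {f f' : ℝ → ℂ}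
    (hf : ∀ x, HasDerivAt f (f' x) x) (hfi : Integrable f) (hf2 : MemLp f 2) (hf'i : Integrable f') (hf'2 : MemLp f' 2)
    (hsupp : ∀ z : ℝ, a < |z| * √q → ∫ x : ℝ, f x * cexp (I * z * x) = 0) :
    1 / (2 * π) * ∫ z : ℝ, (2 / q * liaSym (z * √q)) * ‖∫ x : ℝ, f x * cexp (I * z * x)‖ ^ 2
      ≤ -(1 / 2 * Real.log (1 / a)) * ∫ x : ℝ, ‖f' x‖ ^ 2 := by
  set F : ℝ → ℂ := fun z => ∫ x : ℝ, f x * cexp (I * z * x) with hFdef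
  have hsq : 0 < √q := Real.sqrt_pos.2 hq
  have hlog : 0 ≤ Real.log (1 / a) := Real.log_nonneg (by rw [le_div_iff₀ ha]; linarith)
  -- pointwise: `(2/q)𝔖(z√q)|F z|² ≤ −(z²/2)log(1/a)|F z|²`
  have hpt : ∀ z : ℝ, (2 / q * liaSym (z * √q)) * ‖F z‖ ^ 2 ≤ (-(1 / 2 * Real.log (1 / a)) * z ^ 2) * ‖F z‖ ^ 2 := by
    intro z
    by_cases hz : |z| * √q ≤ a
    · have hx : |z * √q| ≤ a := by rw [abs_mul, abs_of_pos hsq]; exact hz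
      have h := liaSym_le_neg_sq_mul_log ha' hx
      have h2 : 2 / q * liaSym (z * √q) ≤ -(1 / 2 * Real.log (1 / a)) * z ^ 2 := by
        calc 2 / q * liaSym (z * √q) ≤ 2 / q * (-((z * √q) ^ 2 / 4) * Real.log (1 / a)) :=
              mul_le_mul_of_nonneg_left h (by positivity)
          _ = -(1 / 2 * Real.log (1 / a)) * z ^ 2 := by
              rw [mul_pow, Real.sq_sqrt hq.le]; field_simp; ring
      exact mul_le_mul_of_nonneg_right h2 (by positivity)
    · have hF0 : F z = 0 := hsupp z (not_le.1 hz)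
      simp [hF0]
  -- integrability
  have hI2 : Integrable (fun z : ℝ => ‖F z‖ ^ 2) := integrable_norm_sq_unnormalisedTransform hfi hf2
  have hIl : Integrable (fun z : ℝ => (2 / q * liaSym (z * √q)) * ‖F z‖ ^ 2) := by
    refine hI2.bdd_mul (c := 2 / q * 4) ?_ (Eventually.of_forall fun z => ?_)
    · exact ((continuous_const.mul (continuous_liaSym.comp (continuous_id.mul continuous_const))).aestronglyMeasurable)
    · rw [Real.norm_eq_abs, abs_mul, abs_of_pos (by positivity : (0:ℝ) < 2 / q)]
      exact mul_le_mul_of_nonneg_left (abs_liaSym_le_four _) (by positivity)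
  -- `z²|F z|²` is integrable: it is `|transform of f′|²`
  have hI2' : Integrable (fun z : ℝ => ‖∫ x : ℝ, f' x * cexp (I * z * x)‖ ^ 2) := integrable_norm_sq_unnormalisedTransform hf'i hf'2
  have hIz : Integrable (fun z : ℝ => z ^ 2 * ‖F z‖ ^ 2) := by
    refine hI2'.congr (Eventually.of_forall fun z => ?_)
    simp only [hFdef]
    rw [unnormalisedTransform_deriv hf hfi hf'i z, norm_mul, norm_neg, norm_mul, Complex.norm_I, Complex.norm_real, one_mul,
      Real.norm_eq_abs, mul_pow, sq_abs]
  have hIr : Integrable (fun z : ℝ => (-(1 / 2 * Real.log (1 / a)) * z ^ 2) * ‖F z‖ ^ 2) := by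
    refine (hIz.const_mul (-(1 / 2 * Real.log (1 / a)))).congr (Eventually.of_forall fun z => ?_)
    simp only
    ring
  have hmono := integral_mono hIl hIr hpt
  have hR : ∫ z : ℝ, (-(1 / 2 * Real.log (1 / a)) * z ^ 2) * ‖F z‖ ^ 2 = -(1 / 2 * Real.log (1 / a)) * ∫ z : ℝ, z ^ 2 * ‖F z‖ ^ 2 := by
    rw [← integral_const_mul]
    refine integral_congr_ae (Eventually.of_forall fun z => ?_)
    simp only
    ring
  rw [hR] at hmono
  rw [integral_norm_sq_deriv_eq_spectral hf hfi hf'i hf'2]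
  have hpos : (0 : ℝ) < 1 / (2 * π) := by positivity
  calc 1 / (2 * π) * ∫ z : ℝ, (2 / q * liaSym (z * √q)) * ‖F z‖ ^ 2
      ≤ 1 / (2 * π) * (-(1 / 2 * Real.log (1 / a)) * ∫ z : ℝ, z ^ 2 * ‖F z‖ ^ 2) := mul_le_mul_of_nonneg_left hmono hpos.le
    _ = -(1 / 2 * Real.log (1 / a)) * (1 / (2 * π) * ∫ z : ℝ, z ^ 2 * ‖F z‖ ^ 2) := by ring

/-- **LOW REGIME: the model self form is a negative Dirichlet form.**  Under the hypotheses of `spectralForm_le_neg_dirichlet`,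
`Re[(2/q)∫conj f·f − ∫∫K_q(t−u)f(u)conj f(t)] ≤ −½log(1/a)·∫‖f′‖²`. [folklore] -/
theorem modelSelfForm_re_le_neg_dirichlet {q a : ℝ} (hq : 0 < q) (ha : 0 < a) (ha' : a ≤ 1 / 10) {f f' : ℝ → ℂ}
    (hf : ∀ x, HasDerivAt f (f' x) x) (hfi : Integrable f) (hf2 : MemLp f 2) (hf'i : Integrable f') (hf'2 : MemLp f' 2)
    (hsupp : ∀ z : ℝ, a < |z| * √q → ∫ x : ℝ, f x * cexp (I * z * x) = 0) :
    ((2 / q : ℂ) * (∫ t : ℝ, conj (f t) * f t)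
      - ∫ t : ℝ, ∫ u : ℝ, ((((2 * q - (t - u) ^ 2) * (((t - u) ^ 2 + q) ^ (5 / 2 : ℝ))⁻¹ : ℝ)) : ℂ) * f u * conj (f t)).re
      ≤ -(1 / 2 * Real.log (1 / a)) * ∫ x : ℝ, ‖f' x‖ ^ 2 := by
  rw [modelSelfForm_eq_spectral hq hfi hf2, Complex.ofReal_re]
  exact spectralForm_le_neg_dirichlet hq ha ha' hf hfi hf2 hf'i hf'2 hsupp

/-! ## §3 The low-regime estimate for the full model operator -/

/-- Transport in the unweighted pairing, derivative unweighted: `‖∫(−wY′)·conj Y‖ ≤ Λ·(∫‖Y′‖²)^{1/2}·(∫‖(τ−c)Y‖²)^{1/2}`. [folklore] -/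
theorem norm_pairing0_transport_le' {Y Y' : ℝ → ℂ} {c : ℝ} (hY'2 : MemLp Y' 2)
    (hwY2 : MemLp (fun τ : ℝ => ((τ - c : ℝ) : ℂ) * Y τ) 2)
    {w : ℝ → ℝ} (hw : Differentiable ℝ w) {Λ : ℝ} (hΛ : ∀ t, |deriv w t| ≤ Λ) (hwc : w c = 0) :
    ‖∫ τ : ℝ, (-(((w τ : ℝ) : ℂ) * Y' τ)) * conj (Y τ)‖
      ≤ Λ * ((∫ τ : ℝ, ‖Y' τ‖ ^ 2) ^ (1 / 2 : ℝ) * (∫ τ : ℝ, ‖((τ - c : ℝ) : ℂ) * Y τ‖ ^ 2) ^ (1 / 2 : ℝ)) := by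
  have hΛ0 : 0 ≤ Λ := (abs_nonneg _).trans (hΛ c)
  have hslip : ∀ τ, |w τ| ≤ Λ * |τ - c| := abs_slip_le hw hΛ hwc
  have hI : Integrable (fun τ : ℝ => ‖Y' τ‖ * ‖((τ - c : ℝ) : ℂ) * Y τ‖) := hY'2.norm.integrable_mul hwY2.norm
  have hpt : ∀ τ : ℝ, ‖(-(((w τ : ℝ) : ℂ) * Y' τ)) * conj (Y τ)‖ ≤ Λ * (‖Y' τ‖ * ‖((τ - c : ℝ) : ℂ) * Y τ‖) := by
    intro τ
    simp only [norm_mul, norm_neg, Complex.norm_conj, Complex.norm_real, Real.norm_eq_abs]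
    calc |w τ| * ‖Y' τ‖ * ‖Y τ‖ ≤ Λ * |τ - c| * ‖Y' τ‖ * ‖Y τ‖ := by gcongr; exact hslip τ
      _ = Λ * (‖Y' τ‖ * (|τ - c| * ‖Y τ‖)) := by ring
  refine (norm_integral_le_of_norm_le (hI.const_mul Λ) (Eventually.of_forall hpt)).trans ?_
  rw [integral_const_mul]
  exact mul_le_mul_of_nonneg_left (integral_norm_mul_norm_le hY'2 hwY2) hΛ0

/-- **LOW-REGIME DIRICHLET ESTIMATE for the full 1-D model operator.**  Let `q, G > 0`, `0 < a ≤ 1/10`, `c : ℝ`; `Y ∈ C¹` with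
`Y ∈ L¹∩L²`, `Y′ ∈ L¹∩L²`, `(τ−c)Y, (τ−c)Y′ ∈ L²`, `M_qY ∈ L²`, and `Ŷ = 0` on `|z|√q > a`; `w` differentiable real, `w(c) = 0`, `|w′| ≤ Λ`;
`β₁, β₂` measurable, `‖β_i‖ ≤ b_i`.  Then for `𝓛Y = iG·M_qY − wY′ + β₁Y + β₂conj Y`:
`G·½log(1/a)·∫‖Y′‖² ≤ (∫‖𝓛Y‖²)^{1/2}(∫‖Y‖²)^{1/2} + Λ(∫‖Y′‖²)^{1/2}(∫‖(τ−c)Y‖²)^{1/2} + (b₁+b₂)∫‖Y‖²`.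
[folklore; DESIGN-NOTE-28296 §2/§5 at model level, without dyadic slicing] -/
theorem model_lowRegime_dirichlet_estimate {q G a : ℝ} (hq : 0 < q) (hG : 0 < G) (ha : 0 < a) (ha' : a ≤ 1 / 10)
    {Y Y' : ℝ → ℂ} (hY : ∀ τ, HasDerivAt Y (Y' τ) τ) (hY1 : Integrable Y) (hY2 : MemLp Y 2) (hY'1 : Integrable Y') (hY'2 : MemLp Y' 2)
    (c : ℝ) (hwY2 : MemLp (fun τ : ℝ => ((τ - c : ℝ) : ℂ) * Y τ) 2) (hwY'2 : MemLp (fun τ : ℝ => ((τ - c : ℝ) : ℂ) * Y' τ) 2)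
    (hM2 : MemLp (fun τ : ℝ => (2 / q : ℂ) * Y τ
      - ∫ σ : ℝ, ((((2 * q - (τ - σ) ^ 2) * (((τ - σ) ^ 2 + q) ^ (5 / 2 : ℝ))⁻¹ : ℝ)) : ℂ) * Y σ) 2)
    (hsupp : ∀ z : ℝ, a < |z| * √q → ∫ x : ℝ, Y x * cexp (I * z * x) = 0)
    {w : ℝ → ℝ} (hw : Differentiable ℝ w) {Λ : ℝ} (hΛ : ∀ t, |deriv w t| ≤ Λ) (hwc : w c = 0)
    {β₁ β₂ : ℝ → ℂ} (hβ₁m : AEStronglyMeasurable β₁ volume) (hβ₂m : AEStronglyMeasurable β₂ volume) {b₁ b₂ : ℝ}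
    (hb₁ : ∀ τ, ‖β₁ τ‖ ≤ b₁) (hb₂ : ∀ τ, ‖β₂ τ‖ ≤ b₂) :
    G * (1 / 2 * Real.log (1 / a)) * ∫ t : ℝ, ‖Y' t‖ ^ 2
      ≤ (∫ τ : ℝ, ‖I * (G : ℂ) * ((2 / q : ℂ) * Y τ
              - ∫ σ : ℝ, ((((2 * q - (τ - σ) ^ 2) * (((τ - σ) ^ 2 + q) ^ (5 / 2 : ℝ))⁻¹ : ℝ)) : ℂ) * Y σ)
            - ((w τ : ℝ) : ℂ) * Y' τ + β₁ τ * Y τ + β₂ τ * conj (Y τ)‖ ^ 2) ^ (1 / 2 : ℝ) * (∫ τ : ℝ, ‖Y τ‖ ^ 2) ^ (1 / 2 : ℝ)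
        + Λ * ((∫ τ : ℝ, ‖Y' τ‖ ^ 2) ^ (1 / 2 : ℝ) * (∫ τ : ℝ, ‖((τ - c : ℝ) : ℂ) * Y τ‖ ^ 2) ^ (1 / 2 : ℝ))
        + (b₁ + b₂) * ∫ τ : ℝ, ‖Y τ‖ ^ 2 := by
  -- abbreviations (as in `model_selfForm_bound`)
  set MY : ℝ → ℂ := fun τ => (2 / q : ℂ) * Y τ
      - ∫ σ : ℝ, ((((2 * q - (τ - σ) ^ 2) * (((τ - σ) ^ 2 + q) ^ (5 / 2 : ℝ))⁻¹ : ℝ)) : ℂ) * Y σ with hMYdef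
  set TY : ℝ → ℂ := fun τ => -(((w τ : ℝ) : ℂ) * Y' τ) with hTYdef
  set BY : ℝ → ℂ := fun τ => β₁ τ * Y τ + β₂ τ * conj (Y τ) with hBYdef
  set LY : ℝ → ℂ := fun τ => I * (G : ℂ) * MY τ - ((w τ : ℝ) : ℂ) * Y' τ + β₁ τ * Y τ + β₂ τ * conj (Y τ) with hLYdef
  set SF : ℂ := (2 / q : ℂ) * (∫ t : ℝ, conj (Y t) * Y t)
      - ∫ t : ℝ, ∫ u : ℝ, ((((2 * q - (t - u) ^ 2) * (((t - u) ^ 2 + q) ^ (5 / 2 : ℝ))⁻¹ : ℝ)) : ℂ) * Y u * conj (Y t) with hSFdef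
  -- `L²` membership of the pieces
  have hSY2 : MemLp (fun τ => I * (G : ℂ) * MY τ) 2 := hM2.const_mul (I * (G : ℂ))
  have hTY2 : MemLp TY 2 := (memLp_slip_mul hY'2.1 hwY'2 hw hΛ hwc).neg
  have hBY2 : MemLp BY 2 :=
    (memLp_boundedMultiplier_mul hβ₁m hb₁ hY2).add (memLp_boundedMultiplier_mul hβ₂m hb₂ (memLp_conj hY2))
  have hLY2 : MemLp LY 2 := by
    refine ((hSY2.add hTY2).add hBY2).ae_eq (Eventually.of_forall fun τ => ?_)
    simp only [Pi.add_apply, hTYdef, hBYdef, hLYdef]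
    ring
  -- pairings
  have hPM := integrable_mul_conj hM2 hY2
  have hPT := integrable_mul_conj hTY2 hY2
  have hPB := integrable_mul_conj hBY2 hY2
  have hself : ∫ t : ℝ, MY t * conj (Y t) = SF := pairing_modelSelf_eq_selfForm hY2 hM2
  have hsplit : ∫ τ : ℝ, LY τ * conj (Y τ)
      = I * (G : ℂ) * (∫ τ : ℝ, MY τ * conj (Y τ)) + (∫ τ : ℝ, TY τ * conj (Y τ)) + ∫ τ : ℝ, BY τ * conj (Y τ) := by
    have e : (fun τ : ℝ => LY τ * conj (Y τ))
        = fun τ : ℝ => (I * (G : ℂ) * (MY τ * conj (Y τ)) + TY τ * conj (Y τ)) + BY τ * conj (Y τ) := by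
      ext τ
      simp only [hTYdef, hBYdef, hLYdef]
      ring
    have hI0 : Integrable (fun τ : ℝ => I * (G : ℂ) * (MY τ * conj (Y τ))) := hPM.const_mul _
    have hI1 : Integrable (fun τ : ℝ => I * (G : ℂ) * (MY τ * conj (Y τ)) + TY τ * conj (Y τ)) := hI0.add hPT
    rw [e, integral_add hI1 hPB, integral_add hI0 hPT, integral_const_mul]
  -- the Dirichlet gain (§2)
  have hgain := modelSelfForm_re_le_neg_dirichlet hq ha ha' hY hY1 hY2 hY'1 hY'2 hsupp
  -- norms
  set nL : ℝ := (∫ τ : ℝ, ‖LY τ‖ ^ 2) ^ (1 / 2 : ℝ) with hnL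
  set nW : ℝ := (∫ τ : ℝ, ‖((τ - c : ℝ) : ℂ) * Y τ‖ ^ 2) ^ (1 / 2 : ℝ) with hnW
  set nY : ℝ := (∫ τ : ℝ, ‖Y τ‖ ^ 2) ^ (1 / 2 : ℝ) with hnY
  set nY' : ℝ := (∫ τ : ℝ, ‖Y' τ‖ ^ 2) ^ (1 / 2 : ℝ) with hnY'
  set PL : ℂ := ∫ τ : ℝ, LY τ * conj (Y τ) with hPLdef
  set PT : ℂ := ∫ τ : ℝ, TY τ * conj (Y τ) with hPTdef
  set PB : ℂ := ∫ τ : ℝ, BY τ * conj (Y τ) with hPBdef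
  have himag : PL.im = G * SF.re + PT.im + PB.im := by
    rw [hsplit, hself]
    simp only [Complex.add_im]
    rw [show I * (G : ℂ) * SF = I * ((G : ℂ) * SF) by ring, Complex.I_mul_im, Complex.re_ofReal_mul]
  have h3 : |PL.im| ≤ nL * nY := (Complex.abs_im_le_norm _).trans (norm_integral_mul_conj_le hLY2 hY2)
  have h4 : |PT.im| ≤ Λ * (nY' * nW) := (Complex.abs_im_le_norm _).trans (norm_pairing0_transport_le' hY'2 hwY2 hw hΛ hwc)
  have h5 : |PB.im| ≤ (b₁ + b₂) * ∫ τ : ℝ, ‖Y τ‖ ^ 2 :=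
    (Complex.abs_im_le_norm _).trans (norm_pairing0_multiplier_le hb₁ hb₂ hY2)
  have hkey : G * (-SF.re) = -PL.im + PT.im + PB.im := by rw [himag]; ring
  calc G * (1 / 2 * Real.log (1 / a)) * ∫ t : ℝ, ‖Y' t‖ ^ 2
      = G * ((1 / 2 * Real.log (1 / a)) * ∫ t : ℝ, ‖Y' t‖ ^ 2) := by ring
    _ ≤ G * (-SF.re) := mul_le_mul_of_nonneg_left (by linarith [hgain]) hG.le
    _ = -PL.im + PT.im + PB.im := hkey
    _ ≤ |PL.im| + |PT.im| + |PB.im| := by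
        have e1 := neg_le_abs (PL.im); have e2 := le_abs_self (PT.im); have e3 := le_abs_self (PB.im)
        linarith
    _ ≤ nL * nY + Λ * (nY' * nW) + (b₁ + b₂) * ∫ τ : ℝ, ‖Y τ‖ ^ 2 := by gcongr

end Summit.NavierStokesRegularity.NavierStokesRegularity.Theorems.MatchedKernel

end
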